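import Summits.BirchSwinnertonDyer.Rank1Residual.X11b.Three.JetchevShapeOverK
import HarnessLib

/-!
# Route `ErratumRoadFive`, crux `EulerHalfNotRamNoInertSetAtFive` (item stmt-BirchSwinnertonDyer-19715),
# served-class road `EulerHalfPOnlyMultPotMultTwinAtFive` (crux idea `ramified-twin-ram-transport`):
# THE DESCENT WRAPPER — the Euler-system half from the genus Gross–Zagier BOOKKEEPING, the twin's
# lower half and a SHARP index bound over `K`, by pure arithmetic

Cell `bsd-stepL`, seat `bsd-line-er5-p1-w7` (width copy g9; LEAD g7 WORKER FIT 20:33:38Z / 20:37:56Z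
item «-w7 = descent wrapper `missingUpperBoundAt_of_shaIndexBound_sharp`-RC»). HONEST FRAMING: one
arithmetic theorem, no `def`, no named fact, nothing asserted about BSD; the crux stays OPEN.

x11b3's `X11b.Three.missingUpperBoundAt_of_shaIndexBound_sharp` (`X11b/Three/JetchevShapeOverK.lean`)
derives `Typed.MissingUpperBoundAt W p` from (1) the Gross–Zagier BOOKKEEPING
`exists_shaAn_padicVal_eq_of_heegner` (finiteness of `Ш(E)`, `Ш(E/K)`, the splitting
`v_p #Ш(E/K) = v_p #Ш(E) + v_p #Ш(E^{d_K})` and the index identity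
`v_p #Ш(E)_an + v_p q_d + v_p ∏c(E) + 2 v_p #E^{d_K}_tors = 2 v_p [E(K) : ℤP]`), which it obtains from the
classical Heegner frame (`gross_zagier`, `kolyvagin`, `SatisfiesHeegnerHypothesis`, Manin-good datum),
(2) the twin's `≥`-half `htw`, (3) the Tamagawa transport `htam` and the weight `htamw`, and (4) the
sharp bound `hU : v_p #Ш(E/K) + 2w ≤ 2 v_p [E(K):ℤP]` — by `omega`. In the ramified-twin frame the
bookkeeping (1) has OTHER inputs (Cai–Shu–Tian's genus display with the constant `2^{−μ} = ½`, the
fourth curve `E_q`, `q ∥ d_K`; stub (ii) of the LEAD's fit, seat -w8) and the non-torsion of `P` comes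
from the genus Heegner point (`RamifiedTwinGenusHeegner.exists_genusHeegnerPoint_of_ramifiedTwin`,
p665860), but the ARITHMETIC is identical. This file isolates it:

* `missingUpperBoundAt_of_bookkeeping_of_shaIndexBound_sharp` — from the bookkeeping CONCLUSION
  (hypothesis `hbook`, verbatim the conclusion shape of `exists_shaAn_padicVal_eq_of_heegner`,
  universally in the twist's algebraic central value `qd`), `¬ IsOfFinAddOrder P`, `htam`, `htamw`,
  `htw` and `hU`: `Typed.MissingUpperBoundAt W p`. No field, Heegner, parametrisation or `L`-function
  input; whoever supplies `hbook` (classical frame: x11b3; RC frame: stub (ii)) and `hU` (classical: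
  Jetchev's shape; RC: the port `stub_sharpKolyvaginJetchevGenusRC`) decides the tier.
* (sanity, checked on the farm and NOT re-declared — `dedup.landed`: it is the classical theorem's type)
  feeding `hbook := fun qd hqd ↦ X11b.exists_shaAn_padicVal_eq_of_heegner … qd hqd` and the
  Gross–Zagier non-torsion returns exactly `X11b.missingUpperBoundAt_of_shaIndexBound_sharp`.

References: Jetchev 2008 Thm. 1.1 (shape); Jetchev–Skinner–Wan 2017 §7.4.2; Miller 2011 Def. 1.1;
Gross–Zagier 1986 V (2.1); Cai–Shu–Tian 2014 Thm. 1.1.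
-/

noncomputable section

open scoped Classical

open WeierstrassCurve NumberField Literature.NumberTheory.EllipticCurves
  Literature.NumberTheory.EllipticCurves.ModularForms
  Literature.NumberTheory.EllipticCurves.Rank1Residual
  Literature.NumberTheory.EllipticCurves.KrizLi2019
  Summit.BirchSwinnertonDyer.Rank1Residual

-- D-0017 layout: summit = sub-problem, so `Summit.BirchSwinnertonDyer.BirchSwinnertonDyer.…` is the
-- mandated namespace (same option as the route's sockets files).
set_option linter.dupNamespace false
set_option autoImplicit false

namespace Summit.BirchSwinnertonDyer.BirchSwinnertonDyer.Theorems.RamifiedTwinGenusHeegner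

/-- **The Euler-system half from the Gross–Zagier bookkeeping, the twin's lower half and a sharp
index bound over `K` — pure arithmetic.** For `W/ℚ`, a number field `K`, a point `P ∈ W(K)` of
infinite order and a model `Wd` of the twist: IF for every algebraic central value `qd` of `Wd` the
bookkeeping holds (`Ш(W)`, `Ш(W/K)` finite, `v_p #Ш(W/K) = v_p #Ш(W) + v_p #Ш(Wd)`, and
`#Ш(W)_an = q ∈ ℚ` with `v_p q + v_p qd + v_p ∏c(W) + 2 v_p #Wd_tors = 2 v_p [W(K):ℤP]`), IF
`v_p ∏c(Wd) = v_p ∏c(W) ≤ w`, IF the twist's `≥`-half holds (`v_p (L(Wd,1)/Ω) ≤ v_p #Ш(Wd) +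
v_p ∏c(Wd) − 2 v_p #Wd_tors`) and IF `v_p #Ш(W/K) + 2w ≤ 2 v_p [W(K):ℤP]`, THEN
`v_p #Ш(W) ≤ v_p #Ш(W)_an` (`Typed.MissingUpperBoundAt W p`). Arithmetic:
`v(Ш_W) + v(Ш_d) = v(Ш_K) ≤ 2v(I) − 2w = v(q) + v(q_d) + v(c_W) + 2v(t_d) − 2w
≤ v(q) + v(Ш_d) + v(c_d) + v(c_W) − 2w = v(q) + v(Ш_d) + 2(v(c_W) − w) ≤ v(q) + v(Ш_d)`.
[cite: JetchevSkinnerWan2017, §7.4.2 (eq:shaupper), p. 31] [cite: Jetchev2008, Thm. 1.1 (shape)]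
[cite: Miller2011LMS, Def. 1.1] -/
theorem missingUpperBoundAt_of_bookkeeping_of_shaIndexBound_sharp
    (W : WeierstrassCurve ℚ) [W.IsElliptic] [W.IsGloballyMinimal] (p : ℕ) [Fact p.Prime]
    (K : Type) [Field K] [NumberField K] (P : (W.baseChange K).toAffine.Point)
    (Wd : WeierstrassCurve ℚ) [Wd.IsElliptic] [Wd.IsGloballyMinimal]
    -- the Gross–Zagier BOOKKEEPING (conclusion shape of `exists_shaAn_padicVal_eq_of_heegner`)
    (hbook : ∀ qd : ℚ, Wd.entireLFunction 1 / (Wd.realPeriodRat : ℂ) = (qd : ℂ) →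
      Finite W.sha ∧ Finite (W.baseChange K).sha ∧
        padicValNat p (W.baseChange K).shaOrder =
          padicValNat p W.shaOrder + padicValNat p Wd.shaOrder ∧
        ∃ q : ℚ, shaAn W = (q : ℂ) ∧
          padicValRat p q + padicValRat p qd + padicValNat p W.tamagawaProduct +
              2 * padicValNat p Wd.torsionOrder =
            2 * padicValNat p (AddSubgroup.zmultiples P).index)
    -- the basic point has infinite order
    (hPinf : ¬ IsOfFinAddOrder P)
    -- Tamagawa transport and weight
    (htam : padicValNat p Wd.tamagawaProduct = padicValNat p W.tamagawaProduct)
    {w : ℕ} (htamw : padicValNat p W.tamagawaProduct ≤ w)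
    -- the `≥`-half of the rank-zero `p`-part for the twist
    (htw : ∃ q : ℚ, Wd.entireLFunction 1 / (Wd.realPeriodRat : ℂ) = (q : ℂ) ∧
      padicValRat p q ≤ (padicValNat p Wd.shaOrder : ℤ) + padicValNat p Wd.tamagawaProduct -
        2 * padicValNat p Wd.torsionOrder)
    -- a SHARPENED upper bound of Kolyvagin's shape over `K`
    (hU : Finite (W.baseChange K).sha → ¬ IsOfFinAddOrder P →
      padicValNat p (Nat.card (W.baseChange K).sha) + 2 * w ≤
        2 * padicValNat p (AddSubgroup.zmultiples P).index) :
    Typed.MissingUpperBoundAt W p := by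
  obtain ⟨qd, hqd, hvqd⟩ := htw
  obtain ⟨-, hfinK, hsha, q, hq, hval⟩ := hbook qd hqd
  have hKU : padicValNat p (W.baseChange K).shaOrder + 2 * w ≤
      2 * padicValNat p (AddSubgroup.zmultiples P).index := hU hfinK hPinf
  refine ⟨q, hq, ?_⟩
  have e1 : (padicValNat p (W.baseChange K).shaOrder : ℤ) + 2 * w ≤
      2 * padicValNat p (AddSubgroup.zmultiples P).index := by exact_mod_cast hKU
  have e2 : (padicValNat p (W.baseChange K).shaOrder : ℤ) =
      padicValNat p W.shaOrder + padicValNat p Wd.shaOrder := by exact_mod_cast hsha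
  have e3 : (padicValNat p Wd.tamagawaProduct : ℤ) = padicValNat p W.tamagawaProduct := by
    exact_mod_cast htam
  have e4 : (padicValNat p W.tamagawaProduct : ℤ) ≤ w := by exact_mod_cast htamw
  omega

end Summit.BirchSwinnertonDyer.BirchSwinnertonDyer.Theorems.RamifiedTwinGenusHeegner

end
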